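import Summits.RiemannHypothesis.RiemannHypothesis.Theorems.SemilocalLogAtomsB
import Summits.RiemannHypothesis.RiemannHypothesis.Theorems.SemilocalLogAtomsE
import HarnessLib

/-!
# Log-atom enclosures (K): the atoms `113`, `127`, the power atoms `121`, `125`, `128`, and the window ends `log 131`, `log 137`

Cell `rh-explicit` (HOME `run/shared/lean/pub/rh-explicit/`), seat cc-s2-4 gen10 (A4 lane, the Lean side).  Sequel of
`SemilocalLogAtoms{,B,…,J}.lean`: enclosures of `log 113`, `log 127` and of the weights `log p/√p` (7-term log series at
`113 = 112·(1 + 1/112)`, `log 112 = 4 log 2 + log 7`, and `127 = 128·(1 − 1/128)`, `log 128 = 7 log 2`), square roots by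
squaring, and the coarse lower bounds `log 2 + log 5 + log 13 + 1/131 ≤ log 131`, `3 log 2 + log 17 + 1/137 ≤ log 137`
(`Real.one_sub_inv_le_log_of_pos`) — for the walls `q = 127` (`S = {p ≤ 113}`, window `b < (log 131)/2`) and `q = 131`
(`S = {p ≤ 127}`, `b < (log 137)/2`), whose windows `N = 130`, `136` are the first to contain the prime powers `121 = 11²`, `125 = 5³`, `128 = 2⁷` (exact / squared square roots as for `25`, `27`, `64`).  The fine `log 113` enclosure is named `logHundredThirteenLo11/Hi11` (the coarse
`logHundredThirteenLo` lives in `…J.lean`).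

Folklore numerics throughout; nothing here bears on RH.
-/

set_option autoImplicit false
set_option linter.dupNamespace false  -- the mandated namespace repeats `RiemannHypothesis`

noncomputable section

namespace Summit.RiemannHypothesis.RiemannHypothesis.Theorems.SemilocalPolyWitness

open Real
open Literature.NumberTheory.LFunctions
open Literature.Analysis.SpecialFunctions.Real
open Summit.RiemannHypothesis.RiemannHypothesis.Theorems.MotivicDoor.SemilocalMarkov

/-! ### The atom `113` (`log 113` from `113 = 112·(1 + 1/112)`) -/

/-- `(4.72738781870) < log 113` (`Real.abs_log_sub_add_sum_range_le` at `x = -1/112`, 7 terms). -/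
theorem log_hundredthirteen_gt : (4.72738781870 : ℝ) < Real.log 113 := by
  have t : |(-(1 : ℝ) / 112)| < 1 := by rw [abs_of_neg (by norm_num)]; norm_num
  have z := Real.abs_log_sub_add_sum_range_le t 7
  rw [show |(-(1 : ℝ) / 112)| = 1 / 112 by rw [abs_of_neg (by norm_num)]; norm_num] at z
  norm_num [Finset.sum_range_succ] at z
  have e : Real.log (113 / 112) = Real.log 113 - (4 * Real.log 2 + Real.log 7) := by
    rw [Real.log_div (by norm_num) (by norm_num), show (112 : ℝ) = 2 ^ 4 * 7 by norm_num, Real.log_mul (by norm_num) (by norm_num), Real.log_pow]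
    push_cast; ring
  rw [e] at z
  have h2 := Literature.Analysis.SpecialFunctions.Real.log_two_gt_d20
  have h7 := logSevenLo_le
  rw [logSevenLo] at h7
  push_cast at h7
  obtain ⟨z1, z2⟩ := abs_le.1 z
  linarith

/-- `log 113 < 4.72738781872` (`Real.abs_log_sub_add_sum_range_le` at `x = -1/112`, 7 terms). -/
theorem log_hundredthirteen_lt : Real.log 113 < 4.72738781872 := by
  have t : |(-(1 : ℝ) / 112)| < 1 := by rw [abs_of_neg (by norm_num)]; norm_num
  have z := Real.abs_log_sub_add_sum_range_le t 7
  rw [show |(-(1 : ℝ) / 112)| = 1 / 112 by rw [abs_of_neg (by norm_num)]; norm_num] at z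
  norm_num [Finset.sum_range_succ] at z
  have e : Real.log (113 / 112) = Real.log 113 - (4 * Real.log 2 + Real.log 7) := by
    rw [Real.log_div (by norm_num) (by norm_num), show (112 : ℝ) = 2 ^ 4 * 7 by norm_num, Real.log_mul (by norm_num) (by norm_num), Real.log_pow]
    push_cast; ring
  rw [e] at z
  have h2 := Literature.Analysis.SpecialFunctions.Real.log_two_lt_d20
  have h7 := log_seven_le_logSevenHi
  rw [logSevenHi] at h7
  push_cast at h7
  obtain ⟨z1, z2⟩ := abs_le.1 z
  linarith

/-- lower decimal of `log 113` (fine) -/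
def logHundredThirteenLo11 : ℚ := 472738781870 / 100000000000
/-- upper decimal of `log 113` -/
def logHundredThirteenHi11 : ℚ := 472738781872 / 100000000000
/-- `logHundredThirteenLo11 ≤ log 113`. -/
theorem logHundredThirteenLo11_le : (logHundredThirteenLo11 : ℝ) ≤ Real.log 113 := by
  rw [logHundredThirteenLo11]; push_cast; linarith [log_hundredthirteen_gt]
/-- `log 113 ≤ logHundredThirteenHi11`. -/
theorem log_hundredthirteen_le_logHundredThirteenHi11 : Real.log 113 ≤ (logHundredThirteenHi11 : ℝ) := by
  rw [logHundredThirteenHi11]; push_cast; linarith [log_hundredthirteen_lt]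
/-- `10.63014581273465 ≤ √113 ≤ 10.63014581273465`. -/
def sqrtHundredThirteenLo : ℚ := 106301458127346494 / 10000000000000000
/-- upper decimal of `√113` -/
def sqrtHundredThirteenHi : ℚ := 106301458127346495 / 10000000000000000
/-- The atom `113`: weight `log 113/√113`. -/
def atomHundredThirteen : ℕ × AtomQ :=
  (113, ⟨logHundredThirteenLo11, logHundredThirteenHi11, logHundredThirteenLo11 / sqrtHundredThirteenHi, logHundredThirteenHi11 / sqrtHundredThirteenLo⟩)
/-- `atomHundredThirteen` encloses the atom `113` for any `S ∋ 113`. -/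
theorem atomHundredThirteen_encl {S : Finset ℕ} (h : 113 ∈ S) :
    (atomHundredThirteen.2.lo : ℝ) ≤ Real.log atomHundredThirteen.1 ∧ Real.log atomHundredThirteen.1 ≤ (atomHundredThirteen.2.hi : ℝ) ∧
      (atomHundredThirteen.2.wlo : ℝ) ≤ weilSemilocalCoeff S atomHundredThirteen.1 ∧
      weilSemilocalCoeff S atomHundredThirteen.1 ≤ (atomHundredThirteen.2.whi : ℝ) := by
  simp only [atomHundredThirteen]
  push_cast
  have h0 := prime_atom_encl (by norm_num : Nat.Prime 113) h (lo := logHundredThirteenLo11) (hi := logHundredThirteenHi11)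
    (slo := sqrtHundredThirteenLo) (shi := sqrtHundredThirteenHi) (by exact_mod_cast logHundredThirteenLo11_le)
    (by exact_mod_cast log_hundredthirteen_le_logHundredThirteenHi11) (by rw [logHundredThirteenLo11]; norm_num)
    (ratCast_le_sqrt (by rw [sqrtHundredThirteenLo]; norm_num) (by rw [sqrtHundredThirteenLo]; norm_num))
    (sqrt_le_ratCast (by rw [sqrtHundredThirteenHi]; norm_num) (by rw [sqrtHundredThirteenHi]; norm_num))
    (by rw [sqrtHundredThirteenLo]; norm_num)
  push_cast at h0
  exact h0

/-! ### The atom `127` (`log 127` from `127 = 128·(1 − 1/128)`) -/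

/-- `(4.84418708645) < log 127` (`Real.abs_log_sub_add_sum_range_le` at `x = 1/128`, 7 terms). -/
theorem log_hundredtwentyseven_gt : (4.84418708645 : ℝ) < Real.log 127 := by
  have t : |((1 : ℝ) / 128)| < 1 := by rw [abs_of_pos (by norm_num)]; norm_num
  have z := Real.abs_log_sub_add_sum_range_le t 7
  rw [abs_of_pos (by norm_num : (0 : ℝ) < 1 / 128)] at z
  norm_num [Finset.sum_range_succ] at z
  have e : Real.log (127 / 128) = Real.log 127 - (7 * Real.log 2) := by
    rw [Real.log_div (by norm_num) (by norm_num), show (128 : ℝ) = 2 ^ 7 by norm_num, Real.log_pow]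
    push_cast; ring
  rw [e] at z
  have h2 := Literature.Analysis.SpecialFunctions.Real.log_two_gt_d20
  obtain ⟨z1, z2⟩ := abs_le.1 z
  linarith

/-- `log 127 < 4.84418708646` (`Real.abs_log_sub_add_sum_range_le` at `x = 1/128`, 7 terms). -/
theorem log_hundredtwentyseven_lt : Real.log 127 < 4.84418708646 := by
  have t : |((1 : ℝ) / 128)| < 1 := by rw [abs_of_pos (by norm_num)]; norm_num
  have z := Real.abs_log_sub_add_sum_range_le t 7
  rw [abs_of_pos (by norm_num : (0 : ℝ) < 1 / 128)] at z
  norm_num [Finset.sum_range_succ] at z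
  have e : Real.log (127 / 128) = Real.log 127 - (7 * Real.log 2) := by
    rw [Real.log_div (by norm_num) (by norm_num), show (128 : ℝ) = 2 ^ 7 by norm_num, Real.log_pow]
    push_cast; ring
  rw [e] at z
  have h2 := Literature.Analysis.SpecialFunctions.Real.log_two_lt_d20
  obtain ⟨z1, z2⟩ := abs_le.1 z
  linarith

/-- lower decimal of `log 127` (fine) -/
def logHundredTwentySevenLo11 : ℚ := 484418708645 / 100000000000
/-- upper decimal of `log 127` -/
def logHundredTwentySevenHi11 : ℚ := 484418708646 / 100000000000
/-- `logHundredTwentySevenLo11 ≤ log 127`. -/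
theorem logHundredTwentySevenLo11_le : (logHundredTwentySevenLo11 : ℝ) ≤ Real.log 127 := by
  rw [logHundredTwentySevenLo11]; push_cast; linarith [log_hundredtwentyseven_gt]
/-- `log 127 ≤ logHundredTwentySevenHi11`. -/
theorem log_hundredtwentyseven_le_logHundredTwentySevenHi11 : Real.log 127 ≤ (logHundredTwentySevenHi11 : ℝ) := by
  rw [logHundredTwentySevenHi11]; push_cast; linarith [log_hundredtwentyseven_lt]
/-- `11.269427669584644 ≤ √127 ≤ 11.269427669584644`. -/
def sqrtHundredTwentySevenLo : ℚ := 112694276695846448 / 10000000000000000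
/-- upper decimal of `√127` -/
def sqrtHundredTwentySevenHi : ℚ := 112694276695846449 / 10000000000000000
/-- The atom `127`: weight `log 127/√127`. -/
def atomHundredTwentySeven : ℕ × AtomQ :=
  (127, ⟨logHundredTwentySevenLo11, logHundredTwentySevenHi11, logHundredTwentySevenLo11 / sqrtHundredTwentySevenHi, logHundredTwentySevenHi11 / sqrtHundredTwentySevenLo⟩)
/-- `atomHundredTwentySeven` encloses the atom `127` for any `S ∋ 127`. -/
theorem atomHundredTwentySeven_encl {S : Finset ℕ} (h : 127 ∈ S) :
    (atomHundredTwentySeven.2.lo : ℝ) ≤ Real.log atomHundredTwentySeven.1 ∧ Real.log atomHundredTwentySeven.1 ≤ (atomHundredTwentySeven.2.hi : ℝ) ∧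
      (atomHundredTwentySeven.2.wlo : ℝ) ≤ weilSemilocalCoeff S atomHundredTwentySeven.1 ∧
      weilSemilocalCoeff S atomHundredTwentySeven.1 ≤ (atomHundredTwentySeven.2.whi : ℝ) := by
  simp only [atomHundredTwentySeven]
  push_cast
  have h0 := prime_atom_encl (by norm_num : Nat.Prime 127) h (lo := logHundredTwentySevenLo11) (hi := logHundredTwentySevenHi11)
    (slo := sqrtHundredTwentySevenLo) (shi := sqrtHundredTwentySevenHi) (by exact_mod_cast logHundredTwentySevenLo11_le)
    (by exact_mod_cast log_hundredtwentyseven_le_logHundredTwentySevenHi11) (by rw [logHundredTwentySevenLo11]; norm_num)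
    (ratCast_le_sqrt (by rw [sqrtHundredTwentySevenLo]; norm_num) (by rw [sqrtHundredTwentySevenLo]; norm_num))
    (sqrt_le_ratCast (by rw [sqrtHundredTwentySevenHi]; norm_num) (by rw [sqrtHundredTwentySevenHi]; norm_num))
    (by rw [sqrtHundredTwentySevenLo]; norm_num)
  push_cast at h0
  exact h0

/-! ### The power atoms `121 = 11²`, `125 = 5³`, `128 = 2⁷` (first needed at `N ≥ 121`) -/

/-- The atom `121 = 11²`: `log 121 = 2 log 11`, weight `log 11/11`. -/
def atomHundredTwentyOne : ℕ × AtomQ := (121, ⟨2 * logElevenLo, 2 * logElevenHi, logElevenLo / 11, logElevenHi / 11⟩)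
/-- `atomHundredTwentyOne` encloses the atom `121` for any `S ∋ 11`. -/
theorem atomHundredTwentyOne_encl {S : Finset ℕ} (h : 11 ∈ S) :
    (atomHundredTwentyOne.2.lo : ℝ) ≤ Real.log atomHundredTwentyOne.1 ∧
      Real.log atomHundredTwentyOne.1 ≤ (atomHundredTwentyOne.2.hi : ℝ) ∧
      (atomHundredTwentyOne.2.wlo : ℝ) ≤ weilSemilocalCoeff S atomHundredTwentyOne.1 ∧
      weilSemilocalCoeff S atomHundredTwentyOne.1 ≤ (atomHundredTwentyOne.2.whi : ℝ) := by
  simp only [atomHundredTwentyOne]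
  rw [show (121 : ℕ) = 11 ^ 2 by norm_num]
  have e121 : Real.sqrt ((11 ^ 2 : ℕ) : ℝ) = 11 := by
    rw [show ((11 ^ 2 : ℕ) : ℝ) = (11 : ℝ) ^ 2 by norm_num, Real.sqrt_sq (by norm_num)]
  have h0 := pow_atom_encl_of_bounds (by norm_num : Nat.Prime 11) two_ne_zero h (lo := logElevenLo) (hi := logElevenHi)
    (slo := 11) (shi := 11) (by exact_mod_cast logElevenLo_le) (by exact_mod_cast log_eleven_le_logElevenHi)
    (by rw [logElevenLo]; norm_num) (by rw [e121]; norm_num) (by rw [e121]; norm_num) (by norm_num)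
  push_cast at h0 ⊢
  exact h0

/-- lower decimal of `√125` -/
def sqrtHundredTwentyFiveLo : ℚ := 111803398874989484 / 10000000000000000
/-- upper decimal of `√125` -/
def sqrtHundredTwentyFiveHi : ℚ := 111803398874989485 / 10000000000000000
/-- The atom `125 = 5³`: `log 125 = 3 log 5`, weight `log 5/√125`. -/
def atomHundredTwentyFive : ℕ × AtomQ :=
  (125, ⟨3 * logFiveLo, 3 * logFiveHi, logFiveLo / sqrtHundredTwentyFiveHi, logFiveHi / sqrtHundredTwentyFiveLo⟩)
/-- `atomHundredTwentyFive` encloses the atom `125` for any `S ∋ 5`. -/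
theorem atomHundredTwentyFive_encl {S : Finset ℕ} (h : 5 ∈ S) :
    (atomHundredTwentyFive.2.lo : ℝ) ≤ Real.log atomHundredTwentyFive.1 ∧
      Real.log atomHundredTwentyFive.1 ≤ (atomHundredTwentyFive.2.hi : ℝ) ∧
      (atomHundredTwentyFive.2.wlo : ℝ) ≤ weilSemilocalCoeff S atomHundredTwentyFive.1 ∧
      weilSemilocalCoeff S atomHundredTwentyFive.1 ≤ (atomHundredTwentyFive.2.whi : ℝ) := by
  simp only [atomHundredTwentyFive]
  rw [show (125 : ℕ) = 5 ^ 3 by norm_num]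
  have e125 : Real.sqrt ((5 ^ 3 : ℕ) : ℝ) = Real.sqrt 125 := by norm_num
  have h0 := pow_atom_encl_of_bounds (by norm_num : Nat.Prime 5) (by norm_num : (3 : ℕ) ≠ 0) h (lo := logFiveLo)
    (hi := logFiveHi) (slo := sqrtHundredTwentyFiveLo) (shi := sqrtHundredTwentyFiveHi) (by exact_mod_cast logFiveLo_le)
    (by exact_mod_cast log_five_le_logFiveHi) (by rw [logFiveLo]; norm_num)
    (by rw [e125]; exact ratCast_le_sqrt (by rw [sqrtHundredTwentyFiveLo]; norm_num) (by rw [sqrtHundredTwentyFiveLo]; norm_num))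
    (by rw [e125]; exact sqrt_le_ratCast (by rw [sqrtHundredTwentyFiveHi]; norm_num) (by rw [sqrtHundredTwentyFiveHi]; norm_num))
    (by rw [sqrtHundredTwentyFiveLo]; norm_num)
  push_cast at h0 ⊢
  exact h0

/-- lower decimal of `√128` -/
def sqrtHundredTwentyEightLo : ℚ := 113137084989847603 / 10000000000000000
/-- upper decimal of `√128` -/
def sqrtHundredTwentyEightHi : ℚ := 113137084989847604 / 10000000000000000
/-- The atom `128 = 2⁷`: `log 128 = 7 log 2`, weight `log 2/√128`. -/
def atomHundredTwentyEight : ℕ × AtomQ :=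
  (128, ⟨7 * logTwoLo20, 7 * logTwoHi20, logTwoLo20 / sqrtHundredTwentyEightHi, logTwoHi20 / sqrtHundredTwentyEightLo⟩)
/-- `atomHundredTwentyEight` encloses the atom `128` for any `S ∋ 2`. -/
theorem atomHundredTwentyEight_encl {S : Finset ℕ} (h : 2 ∈ S) :
    (atomHundredTwentyEight.2.lo : ℝ) ≤ Real.log atomHundredTwentyEight.1 ∧
      Real.log atomHundredTwentyEight.1 ≤ (atomHundredTwentyEight.2.hi : ℝ) ∧
      (atomHundredTwentyEight.2.wlo : ℝ) ≤ weilSemilocalCoeff S atomHundredTwentyEight.1 ∧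
      weilSemilocalCoeff S atomHundredTwentyEight.1 ≤ (atomHundredTwentyEight.2.whi : ℝ) := by
  simp only [atomHundredTwentyEight]
  rw [show (128 : ℕ) = 2 ^ 7 by norm_num]
  have e128 : Real.sqrt ((2 ^ 7 : ℕ) : ℝ) = Real.sqrt 128 := by norm_num
  have h0 := pow_atom_encl_of_bounds Nat.prime_two (by norm_num : (7 : ℕ) ≠ 0) h (lo := logTwoLo20)
    (hi := logTwoHi20) (slo := sqrtHundredTwentyEightLo) (shi := sqrtHundredTwentyEightHi) (by exact_mod_cast logTwoLo20_le)
    (by exact_mod_cast log_two_le_logTwoHi20) (by rw [logTwoLo20]; norm_num)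
    (by rw [e128]; exact ratCast_le_sqrt (by rw [sqrtHundredTwentyEightLo]; norm_num) (by rw [sqrtHundredTwentyEightLo]; norm_num))
    (by rw [e128]; exact sqrt_le_ratCast (by rw [sqrtHundredTwentyEightHi]; norm_num) (by rw [sqrtHundredTwentyEightHi]; norm_num))
    (by rw [sqrtHundredTwentyEightLo]; norm_num)
  push_cast at h0 ⊢
  exact h0

/-! ### Lower bounds of `log 131` and `log 137` (window ends of the walls `q = 127`, `q = 131`) -/

/-- `log 2⁻ + log 5⁻ + log 13⁻ + 1/131 ≤ log 131`: `log 131 = log 130 + log (131/130) ≥ log 2 + log 5 + log 13 + (1 − 130/131)`. -/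
def logHundredThirtyOneLo : ℚ := logTwoLo20 + logFiveLo + logThirteenLo + 1 / 131
/-- `logHundredThirtyOneLo ≤ log 131`. -/
theorem logHundredThirtyOneLo_le : (logHundredThirtyOneLo : ℝ) ≤ Real.log 131 := by
  have h130 : Real.log 130 = Real.log 2 + Real.log 5 + Real.log 13 := by
    rw [show (130 : ℝ) = 2 * 5 * 13 by norm_num, Real.log_mul (by norm_num) (by norm_num), Real.log_mul (by norm_num) (by norm_num)]
  have hq : Real.log 131 = Real.log 2 + Real.log 5 + Real.log 13 + Real.log (131 / 130) := by
    rw [← h130, ← Real.log_mul (by norm_num) (by norm_num)]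
    norm_num
  have hlow : 1 - (131 / 130 : ℝ)⁻¹ ≤ Real.log (131 / 130) := Real.one_sub_inv_le_log_of_pos (by norm_num)
  have h2 := logTwoLo20_le
  have h5 := logFiveLo_le
  have h13 := logThirteenLo_le
  rw [logHundredThirtyOneLo]
  push_cast
  rw [hq]
  norm_num at hlow ⊢
  linarith

/-- `3 log 2⁻ + log 17⁻ + 1/137 ≤ log 137`: `log 137 = log 136 + log (137/136) ≥ 3 log 2 + log 17 + (1 − 136/137)`. -/
def logHundredThirtySevenLo : ℚ := 3 * logTwoLo20 + logSeventeenLo + 1 / 137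
/-- `logHundredThirtySevenLo ≤ log 137`. -/
theorem logHundredThirtySevenLo_le : (logHundredThirtySevenLo : ℝ) ≤ Real.log 137 := by
  have h136 : Real.log 136 = 3 * Real.log 2 + Real.log 17 := by
    rw [show (136 : ℝ) = 2 ^ 3 * 17 by norm_num, Real.log_mul (by norm_num) (by norm_num), Real.log_pow]; push_cast; ring
  have hq : Real.log 137 = 3 * Real.log 2 + Real.log 17 + Real.log (137 / 136) := by
    rw [← h136, ← Real.log_mul (by norm_num) (by norm_num)]
    norm_num
  have hlow : 1 - (137 / 136 : ℝ)⁻¹ ≤ Real.log (137 / 136) := Real.one_sub_inv_le_log_of_pos (by norm_num)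
  have h2 := logTwoLo20_le
  have h17 := logSeventeenLo_le
  rw [logHundredThirtySevenLo]
  push_cast
  rw [hq]
  norm_num at hlow ⊢
  linarith

/-! Build note (cc-s2-4 gen11, 2026-08-24; lead R14-3 APPEND REMEDY): comment-only re-commit — accepted 08:09–08:10Z, no hub olean since
(no RH-Theorems build burst after 08:12:58Z).  Users: the wall rows `SemilocalNegCertUptoHundred{Thirteen,TwentySeven}` (q = 127, 131). -/

end Summit.RiemannHypothesis.RiemannHypothesis.Theorems.SemilocalPolyWitness

end
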